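import Mathlib
import Summits.CriticalPhenomena.CardyFormulaZ2.Theorems.CardyMagicRigidityNestingRigidityStaircaseReduction
import Summits.CriticalPhenomena.CardyFormulaZ2.Theorems.CardyMagicRigidityNestingRigidityFirstMomentIdentity
import Literature.Probability.Percolation.SiteNestingWeightIntegrable
import HarnessLib

/-!
# Crux `NestingRigidity`, line `ring-cloud-tomography` (r5): the INTEGRABILITY side conditions of
# the remaining input (QU) of `stub_staircaseDecoupling` (R2'), on both lattices

Crux `Summit.CriticalPhenomena.CardyFormulaZ2.Theses.CardyMagicRigidity.NestingRigidity`
(stmt-CriticalPhenomena-4835), line `ring-cloud-tomography`, stub R2'.  Sequel to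
`…StaircaseReduction` (p122218: `stub_staircaseDecoupling` from the input (QU)).  The input (QU)
carries four integrability side conditions at a FIXED mesh `δ > 0` for the functionals
`g_tot` (finite product of the weights of the window-tower and gap-tower loops), `Θ`, `Θ₂` (finite
sums of the (squared) phases of the remaining loops) and the indicator of the good event `G`:
`g_tot 1_G`, `g_tot Θ 1_G`, `g_tot Θ₂ 1_G`, `g_tot e^{−√3Θ} 1_G` are integrable.  This file proves
all four on both lattice ensembles (registered anchor `Staircase.integrable_inputs_latticeEnsembles`),
with no RSW content: at mesh `δ > 0` only the loops meeting the closed ball carrying the staircase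
density have weight `≠ 1` or phase `≠ 0`, and their number is bounded by a deterministic constant
(`FirstMoment.exists_ncard_loops_meeting_le`), so every functional above is a bounded measurable
function on a probability space:
* §1 measurability of `ω ↦ ∏ᶠ_{u ∈ loops, Q u} g u` on both lattices (`measurable_finprod_loops_sep`,
  the multiplicative twin of `FirstMoment.measurable_finsum_loops_sep`);
* §2 deterministic bounds: `|θ_u| ≤ 2|t|` for every loop against the staircase density, uniform
  bounds on sub-products of loop weights and on rest sums of bounded phase statistics;
* §3 the four integrabilities (and integrability / measurability of `g_tot` itself).
-/

noncomputable section

open MeasureTheory Set Filter Metric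
open scoped Real Topology BigOperators

namespace Summit.CriticalPhenomena.CardyFormulaZ2.Cruxes.NestingRigidity.RingCloudTomography

open Literature.Probability.RandomPlanarGeometry Literature.Probability.Percolation
  Literature.Probability.LatticeModels
open Summit.CriticalPhenomena.CardyFormulaZ2.Cruxes.NestingRigidity.PositiveConeWeightDoubling
  (magicWeight)

-- Local notation: the staircase cloud, its tower loops (window tower ∪ gap towers), the good event.
local notation3 "Stair(" k ", " L ", " M ", " t ", " r ")" =>
  Cloud.mk 1 k (fun _ ↦ (0 : ℂ)) (fun _ ↦ r) (fun _ ↦ t) (fun _ ↦ (0 : ℂ)) L M (fun _ ↦ -t / k)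
local notation3 "Tow(" c ", " k ", " L ", " M ", " r ")" =>
  {u ∈ LoopConfig.loops c | (Metric.closedBall (0 : ℂ) r ⊆ {z | u.wind z ≠ 0} ∧ u.range ⊆ Metric.ball (0 : ℂ) 1) ∨
    ∃ j : Fin k, (j : ℕ) + 1 < k ∧ Metric.closedBall (0 : ℂ) ((M : Fin k → ℝ) j) ⊆ {z | u.wind z ≠ 0} ∧
      ∀ l : Fin k, j < l → u.range ⊆ Metric.ball (0 : ℂ) ((L : Fin k → ℝ) l)}
local notation3 "Good(" c ", " k ", " L ", " M ")" =>
  (∀ u ∈ LoopConfig.loops c, ∀ j₁ j₂ : Fin k, j₁ < j₂ →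
    ¬ ((u.range ∩ Metric.closedBall (0 : ℂ) ((M : Fin k → ℝ) j₁)).Nonempty ∧
      (u.range ∩ (Metric.ball (0 : ℂ) ((L : Fin k → ℝ) j₂))ᶜ).Nonempty))

namespace Staircase

/-! ## §1 Measurability of finite loop products cut out by a predicate, on both lattices -/

/-- `ω ↦ ∏ᶠ_{u ∈ f '' S ω, Q u} g u` is measurable for a random subset `S ω` of a countable index
type with measurable membership events and a deterministic predicate `Q`. -/
theorem measurable_finprod_mem_image_sep {Ω K α : Type*} [MeasurableSpace Ω] [Countable K]
    (f : K → α) {S : Ω → Set K} (hS : ∀ k, Measurable fun ω ↦ k ∈ S ω) (Q : α → Prop)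
    (g : α → ℝ) : Measurable fun ω ↦ ∏ᶠ u ∈ {u ∈ f '' S ω | Q u}, g u := by
  refine measurable_finprod_mem_of_subset_range f (fun ω u hu ↦ ?_) (fun a ↦ ?_) g
  · obtain ⟨⟨k, -, rfl⟩, -⟩ := hu
    exact ⟨k, rfl⟩
  · change Measurable fun ω ↦ (∃ k, k ∈ S ω ∧ f k = a) ∧ Q a
    exact (Measurable.exists fun k ↦ (hS k).and measurable_const).and measurable_const

/-- **On both lattice ensembles `ω ↦ ∏ᶠ_{u ∈ loops, Q u} g u` is measurable** for EVERY
deterministic predicate `Q` and real function `g` on loops (e.g. `g_tot`, the product of the weights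
of the tower loops). -/
theorem measurable_finprod_loops_sep : ∀ E ∈ latticeEnsembles, ∀ (δ : ℝ) (Q : UnbasedLoop ℂ → Prop)
    (g : UnbasedLoop ℂ → ℝ), Measurable fun ω ↦ ∏ᶠ u ∈ {u ∈ (E.X δ ω).loops | Q u}, g u := by
  intro E hE δ Q g
  haveI := countable_sigma_hexLoop
  simp only [latticeEnsembles, Set.mem_insert_iff, Set.mem_singleton_iff] at hE
  rcases hE with rfl | rfl
  · simp_rw [loops_zEns_eq_image]
    exact measurable_finprod_mem_image_sep _ measurable_mem_bondIndex Q g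
  · simp_rw [loops_tEns_eq_image]
    exact measurable_finprod_mem_image_sep _ measurable_mem_siteIndex Q g

/-! ## §2 Deterministic bounds -/

section StaircaseCloud

variable {𝔠 : Cloud} {t r : ℝ} {k : ℕ} {L M : Fin k → ℝ}
  (h𝔠 : 𝔠 = Cloud.mk 1 k (fun _ ↦ 0) (fun _ ↦ r) (fun _ ↦ t) (fun _ ↦ 0) L M (fun _ ↦ -t / k))
include h𝔠

/-- **`|θ_u| ≤ 2|t|` for every loop against the staircase density** (bite formula
`θ_u = tφ₀ + (−t/k)Σ_j φ_j`: the bump fraction and the ring fractions all lie in `[0, 1]`, and the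
ring charges total `|t|`). -/
theorem abs_nestingPhase_le (hr : 0 < r) (hL : ∀ j, 0 < L j) (hLM : ∀ j, L j < M j)
    (u : UnbasedLoop ℂ) : |u.nestingPhase 𝔠.density| ≤ 2 * |t| := by
  rw [nestingPhase_eq h𝔠 u]
  have h₀ := ConeTilt.setIntegral_discDensity_mem_Icc 0 hr {z | u.wind z ≠ 0}
  have h₁ : ∀ j, (∫ z in {z | u.wind z ≠ 0}, annulusDensity 0 (L j) (M j) z) ∈ Set.Icc (0 : ℝ) 1 :=
    fun j ↦ ConeTilt.setIntegral_annulusDensity_mem_Icc 0 (hL j) (hLM j) _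
  have hs0 : 0 ≤ ∑ j, ∫ z in {z | u.wind z ≠ 0}, annulusDensity 0 (L j) (M j) z :=
    Finset.sum_nonneg fun j _ ↦ (h₁ j).1
  have hsk : ∑ j, ∫ z in {z | u.wind z ≠ 0}, annulusDensity 0 (L j) (M j) z ≤ k :=
    (Finset.sum_le_sum fun j _ ↦ (h₁ j).2).trans (by simp)
  have e1 : |t * ∫ z in {z | u.wind z ≠ 0}, discDensity 0 r z| ≤ |t| := by
    rw [abs_mul, abs_of_nonneg h₀.1]
    exact mul_le_of_le_one_right (abs_nonneg t) h₀.2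
  have e2 : |-t / k * ∑ j, ∫ z in {z | u.wind z ≠ 0}, annulusDensity 0 (L j) (M j) z| ≤ |t| := by
    rw [abs_mul, abs_of_nonneg hs0, abs_div, abs_neg, Nat.abs_cast]
    rcases eq_or_ne (k : ℝ) 0 with hk | hk
    · rw [hk, div_zero, zero_mul]; exact abs_nonneg t
    · calc |t| / k * ∑ j, ∫ z in {z | u.wind z ≠ 0}, annulusDensity 0 (L j) (M j) z
          ≤ |t| / k * k := mul_le_mul_of_nonneg_left hsk (div_nonneg (abs_nonneg t) (Nat.cast_nonneg k))
        _ = |t| := div_mul_cancel₀ _ hk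
  calc |t * (∫ z in {z | u.wind z ≠ 0}, discDensity 0 r z) +
        -t / k * ∑ j, ∫ z in {z | u.wind z ≠ 0}, annulusDensity 0 (L j) (M j) z|
      ≤ |t * ∫ z in {z | u.wind z ≠ 0}, discDensity 0 r z| +
          |-t / k * ∑ j, ∫ z in {z | u.wind z ≠ 0}, annulusDensity 0 (L j) (M j) z| := abs_add_le _ _
    _ ≤ |t| + |t| := add_le_add e1 e2
    _ = 2 * |t| := by ring

end StaircaseCloud

/-- **Uniform bound on sub-products of loop weights on both lattices**: at mesh `δ > 0`, for a
density vanishing off `B̄(0, R)` with mean zero, `|∏ᶠ_{u ∈ A} w_u| ≤ 2^N` for ONE `N = N(δ, R)`, all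
samples and ALL sub-families `A` of the loops (only loops meeting `B̄(0, R)` weigh `≠ 1`). -/
theorem exists_abs_finprod_nestingFactor_le : ∀ E ∈ latticeEnsembles, ∀ {δ : ℝ}, 0 < δ →
    ∀ {f : ℂ → ℝ} {R : ℝ}, (∀ z, R < ‖z‖ → f z = 0) → ∫ z, f z = 0 →
    ∃ N : ℕ, ∀ (ω : E.Ω) (A : Set (UnbasedLoop ℂ)), A ⊆ (E.X δ ω).loops →
      |∏ᶠ u ∈ A, u.nestingFactor f| ≤ 2 ^ N := by
  intro E hE δ hδ f R hR h0
  obtain ⟨N, hN⟩ := FirstMoment.exists_ncard_loops_meeting_le E hE hδ R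
  refine ⟨N, fun ω A hA ↦ ?_⟩
  obtain ⟨hfin, hle⟩ := hN ω
  exact abs_finprod_mem_le_two_pow (fun u ↦ UnbasedLoop.abs_nestingFactor_le f u) hfin
    (fun u hu ↦ ⟨hA hu.1, range_inter_closedBall_nonempty_of_nestingFactor_ne_one hR h0 hu.2⟩) hle

/-- **Uniform bound on rest sums of phase-supported loop statistics on both lattices**: if
`|g| ≤ C` and `g u = 0` whenever the phase `θ_u` against a density (vanishing off `B̄(0, R)`, mean
zero) vanishes, then `|∑ᶠ_{u ∈ loops ∖ T} g u| ≤ C · N(δ, R)` for all samples and ALL excluded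
families `T`. -/
theorem exists_abs_finsum_sdiff_le : ∀ E ∈ latticeEnsembles, ∀ {δ : ℝ}, 0 < δ →
    ∀ {f : ℂ → ℝ} {R : ℝ}, (∀ z, R < ‖z‖ → f z = 0) → ∫ z, f z = 0 →
    ∀ (g : UnbasedLoop ℂ → ℝ) {C : ℝ}, 0 ≤ C → (∀ u, |g u| ≤ C) →
    (∀ u : UnbasedLoop ℂ, u.nestingPhase f = 0 → g u = 0) →
    ∃ B : ℝ, 0 ≤ B ∧ ∀ (ω : E.Ω) (T : Set (UnbasedLoop ℂ)), |∑ᶠ u ∈ (E.X δ ω).loops \ T, g u| ≤ B := by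
  intro E hE δ hδ f R hR h0 g C hC0 hC hg
  obtain ⟨N, hN⟩ := FirstMoment.exists_ncard_loops_meeting_le E hE hδ R
  refine ⟨C * N, by positivity, fun ω T ↦ ?_⟩
  obtain ⟨hfin, hle⟩ := hN ω
  refine (FirstMoment.abs_finsum_mem_le hfin (fun u hu ↦ ⟨hu.1.1, ?_⟩) hC0 hC).trans ?_
  · by_contra h
    exact hu.2 (hg u (nestingPhase_eq_zero_of_disjoint hR h0
      (Set.disjoint_iff_inter_eq_empty.2 (Set.not_nonempty_iff_eq_empty.1 h))))
  · exact mul_le_mul_of_nonneg_left (by exact_mod_cast hle) hC0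

/-! ## §3 Integrability of the (QU) functionals at a fixed mesh, on both lattices -/

/-- A measurable function with a uniform bound is integrable under the law of a lattice ensemble. -/
theorem integrable_of_abs_le {E : LoopEnsemble} (hE : E ∈ latticeEnsembles) {F : E.Ω → ℝ}
    (hF : Measurable F) {B : ℝ} (hB : ∀ ω, |F ω| ≤ B) : Integrable F E.P := by
  haveI := isProbabilityMeasure_of_mem hE
  exact Integrable.of_bound hF.aestronglyMeasurable B
    (Eventually.of_forall fun ω ↦ by rw [Real.norm_eq_abs]; exact hB ω)

section Functionals

variable {t r : ℝ} {k : ℕ} {L M : Fin k → ℝ}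

/-- **`g_tot` is measurable** on both lattices. -/
theorem measurable_finprod_tow : ∀ E ∈ latticeEnsembles, ∀ (δ : ℝ),
    Measurable fun ω ↦ ∏ᶠ u ∈ Tow(E.X δ ω, k, L, M, r), u.nestingFactor (Stair(k, L, M, t, r)).density :=
  fun E hE δ ↦ measurable_finprod_loops_sep E hE δ _ _

/-- **`g_tot` is uniformly bounded** on both lattices at mesh `δ > 0`: `|g_tot| ≤ 2^N`. -/
theorem exists_abs_finprod_tow_le : ∀ E ∈ latticeEnsembles, ∀ {δ : ℝ}, 0 < δ → 0 < k → 0 < r →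
    (∀ j, r ≤ L j) → (∀ j, 0 < L j) → (∀ j, L j < M j) → (∀ j l, j < l → M j ≤ L l) →
    ∃ N : ℕ, ∀ ω : E.Ω, |∏ᶠ u ∈ Tow(E.X δ ω, k, L, M, r), u.nestingFactor (Stair(k, L, M, t, r)).density| ≤ 2 ^ N := by
  intro E hE δ hδ hk hr hrL hL hLM hsep
  obtain ⟨R, hR, h0⟩ := density_data (t := t) hk hr hrL hL hLM hsep
  obtain ⟨N, hN⟩ := exists_abs_finprod_nestingFactor_le E hE hδ hR h0
  exact ⟨N, fun ω ↦ hN ω _ (Set.sep_subset _ _)⟩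

/-- **`g_tot` is integrable** on both lattices at mesh `δ > 0`. -/
theorem integrable_finprod_tow : ∀ E ∈ latticeEnsembles, ∀ {δ : ℝ}, 0 < δ → 0 < k → 0 < r →
    (∀ j, r ≤ L j) → (∀ j, 0 < L j) → (∀ j, L j < M j) → (∀ j l, j < l → M j ≤ L l) →
    Integrable (fun ω ↦ ∏ᶠ u ∈ Tow(E.X δ ω, k, L, M, r), u.nestingFactor (Stair(k, L, M, t, r)).density) E.P := by
  intro E hE δ hδ hk hr hrL hL hLM hsep
  obtain ⟨N, hN⟩ := exists_abs_finprod_tow_le (t := t) E hE hδ hk hr hrL hL hLM hsep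
  exact integrable_of_abs_le hE (measurable_finprod_tow E hE δ) hN

/-- **The rest sums `Θ`, `Θ₂` are measurable and uniformly bounded** on both lattices at mesh
`δ > 0`: `|Θ| ≤ B`, `|Θ₂| ≤ B` for one `B = B(δ)`. -/
theorem exists_abs_rest_le : ∀ E ∈ latticeEnsembles, ∀ {δ : ℝ}, 0 < δ → 0 < k → 0 < r →
    (∀ j, r ≤ L j) → (∀ j, 0 < L j) → (∀ j, L j < M j) → (∀ j l, j < l → M j ≤ L l) →
    ∃ B : ℝ, 0 ≤ B ∧ ∀ ω : E.Ω,
      |∑ᶠ u ∈ (E.X δ ω).loops \ Tow(E.X δ ω, k, L, M, r), u.nestingPhase (Stair(k, L, M, t, r)).density| ≤ B ∧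
      |∑ᶠ u ∈ (E.X δ ω).loops \ Tow(E.X δ ω, k, L, M, r), u.nestingPhase (Stair(k, L, M, t, r)).density ^ 2| ≤ B := by
  intro E hE δ hδ hk hr hrL hL hLM hsep
  obtain ⟨R, hR, h0⟩ := density_data (t := t) hk hr hrL hL hLM hsep
  have hθ : ∀ u : UnbasedLoop ℂ, |u.nestingPhase (Stair(k, L, M, t, r)).density| ≤ 2 * |t| :=
    fun u ↦ abs_nestingPhase_le (𝔠 := Stair(k, L, M, t, r)) rfl hr hL hLM u
  obtain ⟨B₁, hB₁, h₁⟩ := exists_abs_finsum_sdiff_le E hE hδ hR h0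
    (fun u ↦ u.nestingPhase (Stair(k, L, M, t, r)).density) (by positivity) hθ fun _ h ↦ h
  obtain ⟨B₂, hB₂, h₂⟩ := exists_abs_finsum_sdiff_le E hE hδ hR h0
    (fun u ↦ u.nestingPhase (Stair(k, L, M, t, r)).density ^ 2) (by positivity : (0 : ℝ) ≤ (2 * |t|) ^ 2)
    (fun u ↦ by rw [abs_pow]; exact pow_le_pow_left₀ (abs_nonneg _) (hθ u) 2)
    fun _ h ↦ by rw [h, sq, mul_zero]
  exact ⟨max B₁ B₂, le_max_of_le_left hB₁, fun ω ↦ ⟨(h₁ ω _).trans (le_max_left _ _),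
    (h₂ ω _).trans (le_max_right _ _)⟩⟩

/-- **The four integrability side conditions of (QU)** on both lattices, at every mesh `δ > 0`
and for every admissible staircase (local-notation form; the registered anchor below restates it
with the notation expanded): `g_tot 1_G`, `g_tot Θ 1_G`, `g_tot Θ₂ 1_G`, `g_tot e^{−√3Θ} 1_G`. -/
theorem integrable_inputs : ∀ E ∈ latticeEnsembles, ∀ {δ : ℝ}, 0 < δ → 0 < k → 0 < r →
    (∀ j, r ≤ L j) → (∀ j, 0 < L j) → (∀ j, L j < M j) → (∀ j l, j < l → M j ≤ L l) →
    ∀ (gtot Θ Θ₂ : E.Ω → ℝ) (G : Set E.Ω),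
      (∀ ω, gtot ω = ∏ᶠ u ∈ Tow(E.X δ ω, k, L, M, r), u.nestingFactor (Stair(k, L, M, t, r)).density) →
      (∀ ω, Θ ω = ∑ᶠ u ∈ (E.X δ ω).loops \ Tow(E.X δ ω, k, L, M, r),
        u.nestingPhase (Stair(k, L, M, t, r)).density) →
      (∀ ω, Θ₂ ω = ∑ᶠ u ∈ (E.X δ ω).loops \ Tow(E.X δ ω, k, L, M, r),
        u.nestingPhase (Stair(k, L, M, t, r)).density ^ 2) →
      (G = {ω | Good(E.X δ ω, k, L, M)}) →
      Integrable (fun ω ↦ gtot ω * G.indicator 1 ω) E.P ∧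
      Integrable (fun ω ↦ gtot ω * Θ ω * G.indicator 1 ω) E.P ∧
      Integrable (fun ω ↦ gtot ω * Θ₂ ω * G.indicator 1 ω) E.P ∧
      Integrable (fun ω ↦ gtot ω * Real.exp (-(Real.sqrt 3 * Θ ω)) * G.indicator 1 ω) E.P := by
  intro E hE δ hδ hk hr hrL hL hLM hsep gtot Θ Θ₂ G hg hΘ hΘ₂ hG
  have hgdef : gtot = fun ω ↦ ∏ᶠ u ∈ Tow(E.X δ ω, k, L, M, r), u.nestingFactor (Stair(k, L, M, t, r)).density :=
    funext hg
  have hΘdef : Θ = fun ω ↦ ∑ᶠ u ∈ (E.X δ ω).loops \ Tow(E.X δ ω, k, L, M, r),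
      u.nestingPhase (Stair(k, L, M, t, r)).density := funext hΘ
  have hΘ₂def : Θ₂ = fun ω ↦ ∑ᶠ u ∈ (E.X δ ω).loops \ Tow(E.X δ ω, k, L, M, r),
      u.nestingPhase (Stair(k, L, M, t, r)).density ^ 2 := funext hΘ₂
  -- measurability
  have hgm : Measurable gtot := hgdef ▸ measurable_finprod_tow E hE δ
  have hΘm : Measurable Θ := hΘdef ▸ FirstMoment.measurable_finsum_loops_sdiff_sep E hE δ _ _
  have hΘ₂m : Measurable Θ₂ := hΘ₂def ▸ FirstMoment.measurable_finsum_loops_sdiff_sep E hE δ _ _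
  have hGm : MeasurableSet G := hG ▸ measurableSet_good E hE δ k L M
  have hIm : Measurable (G.indicator (1 : E.Ω → ℝ)) := measurable_const.indicator hGm
  -- uniform bounds
  obtain ⟨N, hN⟩ := exists_abs_finprod_tow_le (t := t) E hE hδ hk hr hrL hL hLM hsep
  obtain ⟨B, hB0, hB⟩ := exists_abs_rest_le (t := t) E hE hδ hk hr hrL hL hLM hsep
  have hgb : ∀ ω, |gtot ω| ≤ 2 ^ N := fun ω ↦ by rw [hg ω]; exact hN ω
  have hΘb : ∀ ω, |Θ ω| ≤ B := fun ω ↦ by rw [hΘ ω]; exact (hB ω).1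
  have hΘ₂b : ∀ ω, |Θ₂ ω| ≤ B := fun ω ↦ by rw [hΘ₂ ω]; exact (hB ω).2
  have hIb : ∀ ω, |G.indicator (1 : E.Ω → ℝ) ω| ≤ 1 := fun ω ↦ by
    by_cases hω : ω ∈ G
    · rw [Set.indicator_of_mem hω, Pi.one_apply, abs_one]
    · rw [Set.indicator_of_notMem hω, abs_zero]; exact zero_le_one
  have hEb : ∀ ω, |Real.exp (-(Real.sqrt 3 * Θ ω))| ≤ Real.exp (Real.sqrt 3 * B) := fun ω ↦ by
    rw [Real.abs_exp]
    refine Real.exp_le_exp.2 ?_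
    have h3 : 0 ≤ Real.sqrt 3 := Real.sqrt_nonneg 3
    nlinarith [abs_le.1 (hΘb ω), h3]
  have h2N : (0 : ℝ) ≤ 2 ^ N := by positivity
  refine ⟨integrable_of_abs_le hE (hgm.mul hIm) (B := 2 ^ N * 1) fun ω ↦ ?_,
    integrable_of_abs_le hE ((hgm.mul hΘm).mul hIm) (B := 2 ^ N * B * 1) fun ω ↦ ?_,
    integrable_of_abs_le hE ((hgm.mul hΘ₂m).mul hIm) (B := 2 ^ N * B * 1) fun ω ↦ ?_,
    integrable_of_abs_le hE ((hgm.mul (Real.measurable_exp.comp (hΘm.const_mul _).neg)).mul hIm)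
      (B := 2 ^ N * Real.exp (Real.sqrt 3 * B) * 1) fun ω ↦ ?_⟩
  · rw [abs_mul]
    exact mul_le_mul (hgb ω) (hIb ω) (abs_nonneg _) h2N
  · rw [abs_mul, abs_mul]
    exact mul_le_mul (mul_le_mul (hgb ω) (hΘb ω) (abs_nonneg _) h2N) (hIb ω) (abs_nonneg _)
      (by positivity)
  · rw [abs_mul, abs_mul]
    exact mul_le_mul (mul_le_mul (hgb ω) (hΘ₂b ω) (abs_nonneg _) h2N) (hIb ω) (abs_nonneg _)
      (by positivity)
  · rw [abs_mul, abs_mul]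
    exact mul_le_mul (mul_le_mul (hgb ω) (hEb ω) (abs_nonneg _) h2N) (hIb ω) (abs_nonneg _)
      (by positivity)

end Functionals

end Staircase

/-- **Registered anchor — the four integrability side conditions of the input (QU) of
`staircaseDecoupling_of_inputs`, on both lattice ensembles.**  For `E ∈ latticeEnsembles`, every
mesh `δ > 0` and every admissible staircase (`0 < k`, `0 < r ≤ L j`, `0 < L j < M j`, `M j ≤ L l` for
`j < l`), with `g_tot` the finite product of the weights of the tower loops (window tower ∪ gap
towers), `Θ`, `Θ₂` the finite sums of the (squared) phases of the remaining loops and `G` the good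
event (no loop meets `B̄(0, M j₁)` and `ℂ ∖ B(0, L j₂)` for `j₁ < j₂`), the four functions
`g_tot 1_G`, `g_tot Θ 1_G`, `g_tot Θ₂ 1_G`, `g_tot e^{−√3Θ} 1_G` are integrable under `E.P`
(bounded measurable functions on a probability space: finitely many loops meet the ball carrying the
density at a fixed mesh). -/
theorem staircase_integrable_inputs_latticeEnsembles : ∀ E ∈ latticeEnsembles, ∀ (δ t r : ℝ) (k : ℕ)
    (L M : Fin k → ℝ), 0 < δ → 0 < k → 0 < r → (∀ j, r ≤ L j) → (∀ j, 0 < L j) → (∀ j, L j < M j) →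
    (∀ j l, j < l → M j ≤ L l) → ∀ (gtot Θ Θ₂ : E.Ω → ℝ) (G : Set E.Ω),
      (∀ ω, gtot ω = ∏ᶠ u ∈ {u ∈ (E.X δ ω).loops | (Metric.closedBall (0 : ℂ) r ⊆ {z | u.wind z ≠ 0} ∧
          u.range ⊆ Metric.ball (0 : ℂ) 1) ∨ ∃ j : Fin k, (j : ℕ) + 1 < k ∧
          Metric.closedBall (0 : ℂ) (M j) ⊆ {z | u.wind z ≠ 0} ∧ ∀ l : Fin k, j < l → u.range ⊆ Metric.ball (0 : ℂ) (L l)},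
        u.nestingFactor (Cloud.mk 1 k (fun _ ↦ 0) (fun _ ↦ r) (fun _ ↦ t) (fun _ ↦ 0) L M (fun _ ↦ -t / k)).density) →
      (∀ ω, Θ ω = ∑ᶠ u ∈ (E.X δ ω).loops \ {u ∈ (E.X δ ω).loops | (Metric.closedBall (0 : ℂ) r ⊆ {z | u.wind z ≠ 0} ∧
          u.range ⊆ Metric.ball (0 : ℂ) 1) ∨ ∃ j : Fin k, (j : ℕ) + 1 < k ∧
          Metric.closedBall (0 : ℂ) (M j) ⊆ {z | u.wind z ≠ 0} ∧ ∀ l : Fin k, j < l → u.range ⊆ Metric.ball (0 : ℂ) (L l)},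
        u.nestingPhase (Cloud.mk 1 k (fun _ ↦ 0) (fun _ ↦ r) (fun _ ↦ t) (fun _ ↦ 0) L M (fun _ ↦ -t / k)).density) →
      (∀ ω, Θ₂ ω = ∑ᶠ u ∈ (E.X δ ω).loops \ {u ∈ (E.X δ ω).loops | (Metric.closedBall (0 : ℂ) r ⊆ {z | u.wind z ≠ 0} ∧
          u.range ⊆ Metric.ball (0 : ℂ) 1) ∨ ∃ j : Fin k, (j : ℕ) + 1 < k ∧
          Metric.closedBall (0 : ℂ) (M j) ⊆ {z | u.wind z ≠ 0} ∧ ∀ l : Fin k, j < l → u.range ⊆ Metric.ball (0 : ℂ) (L l)},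
        u.nestingPhase (Cloud.mk 1 k (fun _ ↦ 0) (fun _ ↦ r) (fun _ ↦ t) (fun _ ↦ 0) L M (fun _ ↦ -t / k)).density ^ 2) →
      (G = {ω | ∀ u ∈ (E.X δ ω).loops, ∀ j₁ j₂ : Fin k, j₁ < j₂ →
        ¬ ((u.range ∩ Metric.closedBall (0 : ℂ) (M j₁)).Nonempty ∧ (u.range ∩ (Metric.ball (0 : ℂ) (L j₂))ᶜ).Nonempty)}) →
      Integrable (fun ω ↦ gtot ω * G.indicator 1 ω) E.P ∧
      Integrable (fun ω ↦ gtot ω * Θ ω * G.indicator 1 ω) E.P ∧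
      Integrable (fun ω ↦ gtot ω * Θ₂ ω * G.indicator 1 ω) E.P ∧
      Integrable (fun ω ↦ gtot ω * Real.exp (-(Real.sqrt 3 * Θ ω)) * G.indicator 1 ω) E.P :=
  fun E hE _ _ _ _ _ _ hδ hk hr hrL hL hLM hsep gtot Θ Θ₂ G hg hΘ hΘ₂ hG ↦
    Staircase.integrable_inputs E hE hδ hk hr hrL hL hLM hsep gtot Θ Θ₂ G hg hΘ hΘ₂ hG

end Summit.CriticalPhenomena.CardyFormulaZ2.Cruxes.NestingRigidity.RingCloudTomography

end
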